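import Literature.AlgebraicGeometry.Motives.TateConjectureDominatedVarieties
import Literature.AlgebraicGeometry.Motives.GaloisActionSemisimpleKunnethProducts
import HarnessLib

/-!
# Algebraic classes on `X × Z` for a factor `Z` with fully algebraic cohomology:
# `K·Aᶜ(X × Z) = ⊕_{p+q=c} K·Aᵖ(X) ⊗ H^{2q}(Z)` (the projective bundle ∕ cellular Künneth formula
# for classes modulo homological equivalence)

Topic `Literature/AlgebraicGeometry/Motives`; THEOREMS ONLY (no definition, no instance, no named fact;
D-0026).

Let `W` be a Weil cohomology theory (Kleiman 1968 §1.2; the tree's `WeilCohomology`), `X`, `Z` smooth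
projective of dimensions `n`, `m`.  Kahn, *Zeta and L-functions of varieties and motives* (2020) Prop. 6.11
proves the **projective line formula** `Aⁿ_∼(X × 𝐏¹, F) ≃ Aⁿ_∼(X, F) ⊕ A^{n−1}_∼(X, F)` (6.4.1) «induced by the
projectors `p` and `1 − p`», and Prop. 6.12 iterates it; for the Chow groups of `X × 𝐏ʳ` this is Fulton's
Th. 3.3 (b).  For classes modulo HOMOLOGICAL equivalence and an arbitrary second factor `Z` ALL OF WHOSE
COHOMOLOGY IS ALGEBRAIC — `K·A^q(Z) = H^{2q}(Z)` for every `q` and `H^{odd}(Z) = 0`, as for `𝐏ʳ`,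
Grassmannians, flag varieties, quadrics of odd dimension — the same statement holds with the same proof,
which this file records in the tree's vocabulary (`algebraicClasses` = the `K`-span `K·Aᵖ`, Künneth
components `kunnethComponent`, Kahn's push-forward `pushforward` and projection formula §3.5.1):

**`K·Aᶜ(X × Z) = Σ_{p+q=c} (K·Aᵖ(X)) × H^{2q}(Z)`** inside `H^{2c}(X × Z) = ⊕ Hᵃ(X) ⊗ Hᵇ(Z)`
(`algebraicClasses_tensor_eq_iSup`), equivalently **a class `z ∈ H^{2c}(X × Z)` is in the `K`-span of the
algebraic classes iff each of its Künneth components `z_{2p,2q}` lies in `K·Aᵖ(X) ⊗ H^{2q}(Z)`**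
(`mem_algebraicClasses_tensor_iff`; the components of odd bidegree vanish with `H^{odd}(Z)`).

The inclusion `⊇` is «`u ⊗ v` algebraic for `u`, `v` algebraic» (Kleiman 1968 §1.3; the tree's
`externalCup_mem_ratAlgebraicClasses`).  The inclusion `⊆` is the transfer argument of Kahn §3.5.1: for
`b′ ∈ H^{2q′}(Z)`, `q + q′ = m`, the correspondence `z ↦ pr_{X*}(z ∪ pr_Z^* b′)` maps `H^{2c}(X × Z)` to
`H^{2p}(X)`, sends algebraic classes to algebraic classes (cup product, pull-back and push-forward preserve
them, Kleiman §1.3), kills every Künneth piece `Hᵃ(X) ⊗ Hᵇ(Z)` with `b ≠ 2q` and is the contraction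
`x ⊗ w ↦ tr_Z(w ∪ b′)·x` on `H^{2p}(X) ⊗ H^{2q}(Z)` (projection formula `pr_{X*}(pr_X^* x ∪ pr_Z^* a) =
tr_Z(a)·x`); when `K·A^{q′}(Z) = H^{2q′}(Z)` these contractions run through ALL linear functionals of
`H^{2q}(Z)` (Poincaré duality), and an element of `V ⊗ W` all of whose contractions against `W^∨` lie in a
subspace `U ⊆ V` lies in `U ⊗ W` (Roman, *Advanced Linear Algebra*, Th. 14.5–14.6: essentially unique
expressions `Σ xᵢ ⊗ vᵢ` over a basis `(vᵢ)` of `W`).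

## What is here

* §0 (linear algebra, namespace `Literature.LinearAlgebra.TensorContraction`): the contraction
  `ρ_φ = rid ∘ (1 ⊗ φ) : V ⊗ W → V`, `v ⊗ w ↦ φ(w)·v` (`rid_lTensor_tmul`); `Σᵢ ρ_{vᵢ^*}(t) ⊗ vᵢ = t` for a
  finite basis (`sum_rid_lTensor_coord_tmul`, Roman Th. 14.6 (3)); contractions of `U ⊗ W` lie in `U`
  (`rid_lTensor_mem_of_mem_map₂`) and conversely **`t ∈ U ⊗ W` iff all its contractions lie in `U`**
  (`mem_map₂_top_iff_forall_rid_lTensor_mem`); a tensor with a trivial factor vanishes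
  (`eq_zero_of_subsingleton_right/left`).
* §1 (any `W`, any field) THE TRANSFER `z ↦ pr_{X*}(z ∪ pr_Z^* b′)`: on external products
  (`pushforward_fst_externalCup_cup_snd` = `tr_Z(w ∪ b′)·x` in the complementary degree, `…_eq_zero`
  otherwise), on a Künneth piece (`pushforward_fst_extTensor_cup_snd`), on any class as the contraction of
  ONE Künneth component (**`pushforward_fst_cup_snd_eq_rid_lTensor_kunnethComponent`**), and its
  algebraicity (`pushforward_fst_cup_snd_mem_ratAlgebraicClasses ∕ _mem_algebraicClasses`).
* §2 `K·Aᵖ(X) × K·A^q(Z) ⊆ K·A^{p+q}(X × Z)` (`map₂_externalCup_algebraicClasses_le`,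
  `extTensor_mem_map₂_externalCup`) and **the Künneth component `z_{2p,2q}` of `z ∈ K·Aᶜ(X × Z)` lies in
  `K·Aᵖ(X) ⊗ H^{2q}(Z)` as soon as `K·A^{m−q}(Z) = H^{2(m−q)}(Z)`**
  (`kunnethComponent_mem_map₂_of_mem_algebraicClasses`; no hypothesis on the other cohomology of `Z`).
* §3 for `Z` with `K·A^q(Z) = H^{2q}(Z)` for all `q` and `b_{odd}(Z) = 0`: **`mem_algebraicClasses_tensor_iff`**,
  **`algebraicClasses_tensor_eq_iSup`**, `kunnethComponent_eq_zero_of_odd_right` (odd pieces vanish),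
  and `algebraicClasses_tensor_eq_top` (**if moreover `K·Aᵖ(X) = H^{2p}(X)` for all `p`, then every
  even-degree class on `X × Z` is algebraic** — products of cellular-type varieties are of cellular type).

What is NOT here: dimension counts (`dim K·Aᶜ(X × Z) = Σ dim K·Aᵖ(X)·b_{2q}(Z)`), the symmetric statement
with the fully algebraic factor on the left, the Galois side (Tate classes of `X × Z`; the next row).
HC is not touched.

## References

* [Kahn2020] B. Kahn, *Zeta and L-Functions of Varieties and Motives*, LMS Lecture Note Series 462 (2020),
  §3.5.1 (push-forward, projection formula, `Tr = p_*`), §6.4 Prop. 6.11 formula (6.4.1) (projective line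
  formula), Prop. 6.12.
* [Fulton1998] W. Fulton, *Intersection Theory*, 2nd ed. (1998), Th. 3.3 (b) (Chow groups of a projective
  bundle), Ex. 1.10.2.
* [Kleiman1968AlgebraicCycles] S. Kleiman, *Algebraic cycles and the Weil conjectures*, in: Dix exposés sur
  la cohomologie des schémas (1968), §1.2 (A)–(C), §1.3.
* [Roman2008] S. Roman, *Advanced Linear Algebra*, 3rd ed., GTM 135 (2008), Ch. 14, Th. 14.5, Th. 14.6.
* Tree: `AbelianVarietyHopf` (`extTensor`, `kunnethComponent`, `sum_extTensor_kunnethComponent`,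
  `kunnethComponent_externalCup_self ∕ _of_ne`), `CorrespondencesTransposeProofs` (`kunneth_induction`),
  `CorrespondencesCompProofs` (`pushforward`, `pdEquiv`), `StandardConjectureCFactorsOfProducts`
  (`pushforward_fst_externalCup`), `KunnethEdgeComponentsOfAlgebraicClasses` (`externalCup_cup_snd`,
  `pushforward_fst_externalCup_eq_zero`, `externalCup_mem_ratAlgebraicClasses`),
  `TateConjectureDominatedVarieties` (`pushforward_mem_algebraicClasses`,
  `cup_mem_algebraicClasses_of_mem_ratAlgebraicClasses`, `map_algebraicClasses_le_of_ratAlgebraicClasses`),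
  `StandardConjecturesHomNumProofs` (`pushforward_mem_ratAlgebraicClasses`).

## Provenance

Lane `lit-hodgefound` (summit `HodgeConjecture`, Track 2 foundations library, Layer B: motives — algebraic
classes and Künneth decompositions), seat `lit-hodgefound-p29` (literature-prover, generation 53, row g53-#1;
FREE POINTER (β) of generation 52).
-/

universe u v

open CategoryTheory AlgebraicGeometry MonoidalCategory CartesianMonoidalCategory
open scoped TensorProduct

noncomputable section

/-! ### §0 Linear algebra: contractions of tensors against functionals on the second factor -/

namespace Literature.LinearAlgebra.TensorContraction

variable {K : Type*} [Field K] {V W : Type*} [AddCommGroup V] [Module K V] [AddCommGroup W] [Module K W]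

/-- The contraction `rid ∘ (1 ⊗ φ)` of `v ⊗ w` against a functional `φ` of the second factor is `φ(w)·v`
(«apply `1 ⊗ β`», the device of the proof of Roman Th. 14.5). [cite: Roman2008, Ch. 14 Th. 14.5 (proof)] -/
theorem rid_lTensor_tmul (φ : W →ₗ[K] K) (v : V) (w : W) :
    TensorProduct.rid K V (LinearMap.lTensor V φ (v ⊗ₜ[K] w)) = φ w • v := by
  rw [LinearMap.lTensor_tmul, TensorProduct.rid_tmul]

/-- **Reconstruction over a basis of the second factor** (Roman Th. 14.6 (3): every `t ∈ V ⊗ W` is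
`Σᵢ xᵢ ⊗ vᵢ` over a basis `(vᵢ)` of `W`, essentially uniquely): the coefficient `xᵢ` is the contraction of
`t` against the coordinate functional `vᵢ^*`. [cite: Roman2008, Ch. 14 Th. 14.6 (3)] -/
theorem sum_rid_lTensor_coord_tmul {ι : Type*} [Fintype ι] (b : Module.Basis ι K W) (t : V ⊗[K] W) :
    ∑ i, TensorProduct.rid K V (LinearMap.lTensor V (b.coord i) t) ⊗ₜ[K] b i = t := by
  induction t using TensorProduct.induction_on with
  | zero => simp
  | tmul v w =>
    simp_rw [rid_lTensor_tmul, TensorProduct.smul_tmul]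
    rw [← TensorProduct.tmul_sum]
    congr 1
    conv_rhs => rw [← b.sum_repr w]
    exact Finset.sum_congr rfl fun i _ ↦ by rw [Module.Basis.coord_apply]
  | add x y hx hy =>
    simp_rw [map_add, TensorProduct.add_tmul, Finset.sum_add_distrib, hx, hy]

/-- The contractions of an element of `U ⊗ W` (the span of the `u ⊗ w`, `u ∈ U`) lie in `U`.
[cite: Roman2008, Ch. 14 Th. 14.5 (proof)] -/
theorem rid_lTensor_mem_of_mem_map₂ (U : Submodule K V) (S : Submodule K W) (φ : W →ₗ[K] K)
    {t : V ⊗[K] W} (ht : t ∈ Submodule.map₂ (TensorProduct.mk K V W) U S) :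
    TensorProduct.rid K V (LinearMap.lTensor V φ t) ∈ U := by
  rw [Submodule.map₂_eq_span_image2] at ht
  induction ht using Submodule.span_induction with
  | mem x hx =>
    obtain ⟨v, hv, w, -, rfl⟩ := hx
    dsimp only
    rw [TensorProduct.mk_apply, rid_lTensor_tmul]
    exact U.smul_mem _ hv
  | zero => rw [map_zero, map_zero]; exact U.zero_mem
  | add x y _ _ hx hy => rw [map_add, map_add]; exact U.add_mem hx hy
  | smul a x _ hx => rw [map_smul, map_smul]; exact U.smul_mem a hx

/-- **An element of `V ⊗ W` all of whose contractions against functionals of `W` lie in `U ⊆ V` lies in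
`U ⊗ W`** (`W` finite-dimensional; expand over a basis, Roman Th. 14.6 (3)). [cite: Roman2008, Ch. 14 Th. 14.6 (3)] -/
theorem mem_map₂_top_of_forall_rid_lTensor_mem [Module.Finite K W] (U : Submodule K V) {t : V ⊗[K] W}
    (h : ∀ φ : W →ₗ[K] K, TensorProduct.rid K V (LinearMap.lTensor V φ t) ∈ U) :
    t ∈ Submodule.map₂ (TensorProduct.mk K V W) U ⊤ := by
  let b := Module.Free.chooseBasis K W
  rw [← sum_rid_lTensor_coord_tmul b t]
  exact Submodule.sum_mem _ fun i _ ↦ Submodule.apply_mem_map₂ _ (h (b.coord i)) Submodule.mem_top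

/-- **`t ∈ U ⊗ W` iff every contraction of `t` against a functional of `W` lies in `U`** (`W`
finite-dimensional). [cite: Roman2008, Ch. 14 Th. 14.5–14.6] -/
theorem mem_map₂_top_iff_forall_rid_lTensor_mem [Module.Finite K W] (U : Submodule K V) (t : V ⊗[K] W) :
    t ∈ Submodule.map₂ (TensorProduct.mk K V W) U ⊤ ↔
      ∀ φ : W →ₗ[K] K, TensorProduct.rid K V (LinearMap.lTensor V φ t) ∈ U :=
  ⟨fun ht φ ↦ rid_lTensor_mem_of_mem_map₂ U ⊤ φ ht, mem_map₂_top_of_forall_rid_lTensor_mem U⟩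

/-- `U ⊗ W ⊆ U′ ⊗ W` with `W ≠ 0` forces `U ⊆ U′` (contract `u ⊗ w`, `φ(w) = 1`; Roman Th. 14.5:
`Σ uᵢ ⊗ vᵢ = 0` with independent `uᵢ` forces `vᵢ = 0`). [cite: Roman2008, Ch. 14 Th. 14.5] -/
theorem le_of_map₂_top_le_map₂_top [Nontrivial W] {U U' : Submodule K V}
    (h : Submodule.map₂ (TensorProduct.mk K V W) U ⊤ ≤ Submodule.map₂ (TensorProduct.mk K V W) U' ⊤) :
    U ≤ U' := by
  intro u hu
  obtain ⟨w, hw⟩ := exists_ne (0 : W)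
  obtain ⟨φ, hφ⟩ := Module.Projective.exists_dual_eq_one K hw
  have hmem := rid_lTensor_mem_of_mem_map₂ U' ⊤ φ
    (h (Submodule.apply_mem_map₂ (TensorProduct.mk K V W) hu (Submodule.mem_top : w ∈ (⊤ : Submodule K W))))
  rwa [TensorProduct.mk_apply, rid_lTensor_tmul, hφ, one_smul] at hmem

/-- A tensor whose second factor is a trivial space vanishes. [cite: Roman2008, Ch. 14 Th. 14.5 («u ⊗ v = 0 iff u = 0 or v = 0»)] -/
theorem eq_zero_of_subsingleton_right [Subsingleton W] (t : V ⊗[K] W) : t = 0 := by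
  induction t using TensorProduct.induction_on with
  | zero => rfl
  | tmul v w => rw [Subsingleton.elim w 0, TensorProduct.tmul_zero]
  | add x y hx hy => rw [hx, hy, add_zero]

/-- A tensor whose first factor is a trivial space vanishes. [cite: Roman2008, Ch. 14 Th. 14.5 («u ⊗ v = 0 iff u = 0 or v = 0»)] -/
theorem eq_zero_of_subsingleton_left [Subsingleton V] (t : V ⊗[K] W) : t = 0 := by
  induction t using TensorProduct.induction_on with
  | zero => rfl
  | tmul v w => rw [Subsingleton.elim v 0, TensorProduct.zero_tmul]
  | add x y hx hy => rw [hx, hy, add_zero]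

end Literature.LinearAlgebra.TensorContraction

namespace Literature.AlgebraicGeometry.Motives

namespace WeilCohomology

open Literature.LinearAlgebra.TensorContraction

variable {k : Type u} [Field k] {K : Type v} [Field K] [CharZero K] (W : WeilCohomology k K)
variable {n m : ℕ} {X Z : SchemeOver k}

/-! ### §1 The transfer `z ↦ pr_{X*}(z ∪ pr_Z^* b′)` along the first projection -/

/-- The transfer formula `pr_{X*}(pr_X^* x ∪ pr_Z^* a) = tr_Z(a)·x` for a top-degree class `a ∈ H^{2m}(Z)`
(the tree's `pushforward_fst_externalCup`), with the source degree `i + 2m` renamed `N'`.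
[cite: Kahn2020, §3.5.1 (projection formula)] -/
theorem pushforward_fst_externalCup_of_eq (hX : IsSmoothProjective n X) (hZ : IsSmoothProjective m Z)
    {i i' N' : ℕ} (hi : i + i' = 2 * n) (h₂ : i + 2 * m = N') (he : N' + i' = 2 * (n + m))
    (x : W.obj X i) (a : W.obj Z (2 * m)) :
    W.pushforward (N := n + m) hX (fst X Z) he hi (W.externalCup X Z h₂ x a) = W.trace Z m a • x := by
  subst h₂
  exact W.pushforward_fst_externalCup hX hZ hi x a he

/-- **The transfer on an external product, complementary degrees**: for `x ∈ Hⁱ(X)`, `w ∈ Hʲ(Z)`,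
`b′ ∈ H^{j′}(Z)` with `j + j′ = 2m`, `pr_{X*}((pr_X^* x ∪ pr_Z^* w) ∪ pr_Z^* b′) = tr_Z(w ∪ b′)·x`
(`(x × w) ∪ pr_Z^* b′ = x × (w ∪ b′)` and the projection formula).  Degrees: `i + j = e`, `e + j′ = s`,
`s + d′ = 2(n + m)`, `i + d′ = 2n`. [cite: Kahn2020, §3.5.1 (projection formula)] [cite: Kleiman1968AlgebraicCycles, §1.2 (A)–(B)] -/
theorem pushforward_fst_externalCup_cup_snd (hX : IsSmoothProjective n X) (hZ : IsSmoothProjective m Z)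
    {i j e j' s d' : ℕ} (hij : i + j = e) (hjj' : j + j' = 2 * m) (hs : e + j' = s)
    (he : s + d' = 2 * (n + m)) (hd : i + d' = 2 * n) (x : W.obj X i) (w : W.obj Z j) (b' : W.obj Z j') :
    W.pushforward (N := n + m) hX (fst X Z) he hd
        (W.cup hs (W.externalCup X Z hij x w) (W.pullback (snd X Z) j' b')) =
      W.trace Z m (W.cup hjj' w b') • x := by
  rw [W.externalCup_cup_snd hX hZ hij hjj' hs (by omega) x w b']
  exact W.pushforward_fst_externalCup_of_eq hX hZ hd (by omega) he x _

/-- **The transfer kills external products of non-complementary degrees**: `j + j′ ≠ 2m ⟹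
pr_{X*}((x × w) ∪ pr_Z^* b′) = pr_{X*}(x × (w ∪ b′)) = 0` (`w ∪ b′` is not of top degree).
[cite: Kahn2020, §3.5.1] [cite: Kleiman1968AlgebraicCycles, §1.2 (A)–(B)] -/
theorem pushforward_fst_externalCup_cup_snd_eq_zero (hX : IsSmoothProjective n X)
    (hZ : IsSmoothProjective m Z) {i j e j' s a d' : ℕ} (hij : i + j = e) (hne : j + j' ≠ 2 * m)
    (hs : e + j' = s) (he : s + d' = 2 * (n + m)) (hd : a + d' = 2 * n) (x : W.obj X i) (w : W.obj Z j)
    (b' : W.obj Z j') :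
    W.pushforward (N := n + m) hX (fst X Z) he hd
        (W.cup hs (W.externalCup X Z hij x w) (W.pullback (snd X Z) j' b')) = 0 := by
  rw [W.externalCup_cup_snd hX hZ hij rfl hs (by omega) x w b']
  exact W.pushforward_fst_externalCup_eq_zero hX hZ _ hne hd he x _

/-- **The transfer on the Künneth piece `Hⁱ(X) ⊗ Hʲ(Z)`, complementary degrees** (`j + j′ = 2m`): it is
the contraction `x ⊗ w ↦ tr_Z(w ∪ b′)·x` against the functional `tr_Z(· ∪ b′)`.
[cite: Kahn2020, §3.5.1 (projection formula)] [cite: Roman2008, Ch. 14 Th. 14.5 (proof)] -/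
theorem pushforward_fst_extTensor_cup_snd (hX : IsSmoothProjective n X) (hZ : IsSmoothProjective m Z)
    {i j e j' s d' : ℕ} (hij : i + j = e) (hjj' : j + j' = 2 * m) (hs : e + j' = s)
    (he : s + d' = 2 * (n + m)) (hd : i + d' = 2 * n) (t : W.obj X i ⊗[K] W.obj Z j) (b' : W.obj Z j') :
    W.pushforward (N := n + m) hX (fst X Z) he hd
        (W.cup hs (W.extTensor hij t) (W.pullback (snd X Z) j' b')) =
      TensorProduct.rid K (W.obj X i)
        (LinearMap.lTensor (W.obj X i) ((W.cupPairing Z m j j' hjj').flip b') t) := by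
  induction t using TensorProduct.induction_on with
  | zero => rw [map_zero, LinearMap.map_zero₂, map_zero, map_zero, map_zero]
  | tmul x w =>
    rw [W.extTensor_tmul, W.pushforward_fst_externalCup_cup_snd hX hZ hij hjj' hs he hd x w b',
      rid_lTensor_tmul, LinearMap.flip_apply, W.cupPairing_apply]
  | add x y hx hy =>
    rw [map_add, LinearMap.map_add₂, map_add, hx, hy, map_add, map_add]

/-- **The transfer on the Künneth piece `Hⁱ(X) ⊗ Hʲ(Z)`, non-complementary degrees**: zero.
[cite: Kahn2020, §3.5.1] [cite: Kleiman1968AlgebraicCycles, §1.2 (A)–(B)] -/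
theorem pushforward_fst_extTensor_cup_snd_eq_zero (hX : IsSmoothProjective n X)
    (hZ : IsSmoothProjective m Z) {i j e j' s a d' : ℕ} (hij : i + j = e) (hne : j + j' ≠ 2 * m)
    (hs : e + j' = s) (he : s + d' = 2 * (n + m)) (hd : a + d' = 2 * n) (t : W.obj X i ⊗[K] W.obj Z j)
    (b' : W.obj Z j') :
    W.pushforward (N := n + m) hX (fst X Z) he hd
        (W.cup hs (W.extTensor hij t) (W.pullback (snd X Z) j' b')) = 0 := by
  induction t using TensorProduct.induction_on with
  | zero => rw [map_zero, LinearMap.map_zero₂, map_zero]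
  | tmul x w =>
    rw [W.extTensor_tmul, W.pushforward_fst_externalCup_cup_snd_eq_zero hX hZ hij hne hs he hd x w b']
  | add x y hx hy => rw [map_add, LinearMap.map_add₂, map_add, hx, hy, add_zero]

/-- **The transfer of any class is the contraction of ONE of its Künneth components**: for
`z ∈ Hᵉ(X × Z)` and `b′ ∈ H^{j′}(Z)`, `pr_{X*}(z ∪ pr_Z^* b′) ∈ Hᵃ(X)` (`a + j = e`, `j + j′ = 2m`) is the
contraction of the component `z_{a,j} ∈ Hᵃ(X) ⊗ Hʲ(Z)` against `tr_Z(· ∪ b′)`; all other components are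
killed (Künneth induction; Kahn §3.5.1, «`α(x) = ⟨x, v⟩ w`» for `α = v ⊗ w`).
[cite: Kahn2020, §3.5.1 and §3.5.4 (proof of Prop. 3.49)] [cite: Kleiman1968AlgebraicCycles, §1.2 (B)] -/
theorem pushforward_fst_cup_snd_eq_rid_lTensor_kunnethComponent (hX : IsSmoothProjective n X)
    (hZ : IsSmoothProjective m Z) {a j e j' s d' : ℕ} (haj : a + j = e) (hjj' : j + j' = 2 * m)
    (hs : e + j' = s) (he : s + d' = 2 * (n + m)) (hd : a + d' = 2 * n) (z : W.obj (X ⊗ Z) e)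
    (b' : W.obj Z j') :
    W.pushforward (N := n + m) hX (fst X Z) he hd (W.cup hs z (W.pullback (snd X Z) j' b')) =
      TensorProduct.rid K (W.obj X a)
        (LinearMap.lTensor (W.obj X a) ((W.cupPairing Z m j j' hjj').flip b')
          (W.kunnethComponent hX hZ a j haj z)) := by
  induction z using W.kunneth_induction hX hZ with
  | zero => rw [LinearMap.map_zero₂, map_zero, map_zero, map_zero, map_zero]
  | add w w' hw hw' => rw [LinearMap.map_add₂, map_add, hw, hw', map_add, map_add, map_add]
  | ext i₁ j₁ h₁ x w =>
    by_cases hij : (a, j) = (i₁, j₁)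
    · obtain ⟨rfl, rfl⟩ := Prod.mk.inj hij
      rw [W.kunnethComponent_externalCup_self hX hZ, rid_lTensor_tmul, LinearMap.flip_apply,
        W.cupPairing_apply, W.pushforward_fst_externalCup_cup_snd hX hZ h₁ hjj' hs he hd x w b']
    · have hj₁ : j₁ + j' ≠ 2 * m := fun h ↦ hij (by
        have : j₁ = j := by omega
        subst this
        obtain rfl : i₁ = a := by omega
        rfl)
      rw [W.kunnethComponent_externalCup_of_ne hX hZ haj h₁ hij, map_zero, map_zero,
        W.pushforward_fst_externalCup_cup_snd_eq_zero hX hZ h₁ hj₁ hs he hd x w b']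

/-- **The transfer preserves rational algebraic classes**: `z ∈ Aᶜ(X × Z)_ℚ`, `b′ ∈ A^{q′}(Z)_ℚ ⟹
pr_{X*}(z ∪ pr_Z^* b′) ∈ Aᵖ(X)_ℚ` (pull-back, cup product and push-forward preserve rational algebraic
classes, Kleiman §1.3).  Degrees: `c + q′ = r`, `2c + 2q′ = 2r`, `2r + d′ = 2(n + m)`, `2p + d′ = 2n`.
[cite: Kleiman1968AlgebraicCycles, §1.3] [cite: Kahn2020, §3.5.1] -/
theorem pushforward_fst_cup_snd_mem_ratAlgebraicClasses (hX : IsSmoothProjective n X)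
    (hZ : IsSmoothProjective m Z) {c q' r p d' : ℕ} (hcq : c + q' = r) (hs : 2 * c + 2 * q' = 2 * r)
    (he : 2 * r + d' = 2 * (n + m)) (hd : 2 * p + d' = 2 * n) {z : W.obj (X ⊗ Z) (2 * c)}
    (hz : z ∈ W.ratAlgebraicClasses (X ⊗ Z) c) {b' : W.obj Z (2 * q')}
    (hb' : b' ∈ W.ratAlgebraicClasses Z q') :
    W.pushforward (N := n + m) hX (fst X Z) he hd (W.cup hs z (W.pullback (snd X Z) (2 * q') b')) ∈
      W.ratAlgebraicClasses X p := by
  have hXZ := IsSmoothProjective.tensor_holds hX hZ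
  have hb'' : W.pullback (snd X Z) (2 * q') b' ∈ W.ratAlgebraicClasses (X ⊗ Z) q' :=
    W.pullback_ratAlgebraicClasses_le hXZ hZ (snd X Z) q' ⟨b', hb', rfl⟩
  exact W.pushforward_mem_ratAlgebraicClasses hXZ hX (fst X Z) he hd
    (W.cup_mem_ratAlgebraicClasses hXZ hcq _ _ hz hb'')

/-- A `K`-linear map sending `Aᵃ(X)_ℚ` into the `K`-span `K·Aᵇ(Y)` sends `K·Aᵃ(X)` into `K·Aᵇ(Y)`
(`K`-linear extension; Kleiman §1.3). [cite: Kleiman1968AlgebraicCycles, §1.3] -/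
theorem map_algebraicClasses_le_of_forall_mem {Y : SchemeOver k} {a b : ℕ}
    (T : W.obj X (2 * a) →ₗ[K] W.obj Y (2 * b))
    (hT : ∀ x ∈ W.ratAlgebraicClasses X a, T x ∈ W.algebraicClasses Y b) :
    (W.algebraicClasses X a).map T ≤ W.algebraicClasses Y b := by
  rw [Submodule.map_le_iff_le_comap]
  change Submodule.span K (W.algebraicLattice X a : Set (W.obj X (2 * a))) ≤ _
  rw [Submodule.span_le]
  intro y hy
  exact hT y (W.algebraicLattice_le_ratAlgebraicClasses X a hy)

/-- **The transfer preserves `K`-spans of algebraic classes**: `z ∈ K·Aᶜ(X × Z)`, `b′ ∈ K·A^{q′}(Z) ⟹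
pr_{X*}(z ∪ pr_Z^* b′) ∈ K·Aᵖ(X)` (bilinear extension of `pushforward_fst_cup_snd_mem_ratAlgebraicClasses`).
[cite: Kleiman1968AlgebraicCycles, §1.3] [cite: Kahn2020, §3.5.1] -/
theorem pushforward_fst_cup_snd_mem_algebraicClasses (hX : IsSmoothProjective n X)
    (hZ : IsSmoothProjective m Z) {c q' r p d' : ℕ} (hcq : c + q' = r) (hs : 2 * c + 2 * q' = 2 * r)
    (he : 2 * r + d' = 2 * (n + m)) (hd : 2 * p + d' = 2 * n) {z : W.obj (X ⊗ Z) (2 * c)}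
    (hz : z ∈ W.algebraicClasses (X ⊗ Z) c) {b' : W.obj Z (2 * q')} (hb' : b' ∈ W.algebraicClasses Z q') :
    W.pushforward (N := n + m) hX (fst X Z) he hd (W.cup hs z (W.pullback (snd X Z) (2 * q') b')) ∈
      W.algebraicClasses X p := by
  -- Step 1: for `b′` rational algebraic, `z ↦ pr_{X*}(z ∪ pr_Z^* b′)` maps `K·Aᶜ(X × Z)` into `K·Aᵖ(X)`.
  have step : ∀ b₁ ∈ W.ratAlgebraicClasses Z q', ∀ z₁ ∈ W.algebraicClasses (X ⊗ Z) c,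
      W.pushforward (N := n + m) hX (fst X Z) he hd (W.cup hs z₁ (W.pullback (snd X Z) (2 * q') b₁)) ∈
        W.algebraicClasses X p := by
    intro b₁ hb₁ z₁ hz₁
    have h := W.map_algebraicClasses_le_of_ratAlgebraicClasses
      ((W.pushforward (N := n + m) hX (fst X Z) he hd) ∘ₗ (W.cup hs).flip (W.pullback (snd X Z) (2 * q') b₁))
      (fun x hx ↦ by
        simpa only [LinearMap.comp_apply, LinearMap.flip_apply] using
          W.pushforward_fst_cup_snd_mem_ratAlgebraicClasses hX hZ hcq hs he hd hx hb₁)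
      ⟨z₁, hz₁, rfl⟩
    simpa only [LinearMap.comp_apply, LinearMap.flip_apply] using h
  -- Step 2: `b′ ↦ pr_{X*}(z ∪ pr_Z^* b′)` is linear and maps `A^{q′}(Z)_ℚ` into `K·Aᵖ(X)`.
  have h := W.map_algebraicClasses_le_of_forall_mem
    ((W.pushforward (N := n + m) hX (fst X Z) he hd) ∘ₗ (W.cup hs z) ∘ₗ W.pullback (snd X Z) (2 * q'))
    (fun b₁ hb₁ ↦ by simpa only [LinearMap.comp_apply] using step b₁ hb₁ z hz) ⟨b', hb', rfl⟩
  simpa only [LinearMap.comp_apply] using h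

/-! ### §2 Künneth pieces of algebraic classes -/

/-- **`K·Aᵖ(X) × K·A^q(Z) ⊆ K·Aᶜ(X × Z)`** (`p + q = c`): the span of the external products `x × w` of
`K`-algebraic classes consists of `K`-algebraic classes (Kleiman §1.3 «`u ⊗ v`»; bilinear extension of the
tree's `externalCup_mem_ratAlgebraicClasses`). [cite: Kleiman1968AlgebraicCycles, §1.3] -/
theorem map₂_externalCup_algebraicClasses_le (hX : IsSmoothProjective n X) (hZ : IsSmoothProjective m Z)
    {p q c : ℕ} (hpq : p + q = c) (h : 2 * p + 2 * q = 2 * c) :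
    Submodule.map₂ (W.externalCup X Z h) (W.algebraicClasses X p) (W.algebraicClasses Z q) ≤
      W.algebraicClasses (X ⊗ Z) c := by
  change Submodule.map₂ _ (Submodule.span K (W.algebraicLattice X p : Set (W.obj X (2 * p))))
    (Submodule.span K (W.algebraicLattice Z q : Set (W.obj Z (2 * q)))) ≤ _
  rw [Submodule.map₂_span_span, Submodule.span_le]
  rintro _ ⟨x, hx, w, hw, rfl⟩
  exact W.ratAlgebraicClasses_le_algebraicClasses (X ⊗ Z) c
    (W.externalCup_mem_ratAlgebraicClasses hX hZ hpq h (W.algebraicLattice_le_ratAlgebraicClasses X p hx)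
      (W.algebraicLattice_le_ratAlgebraicClasses Z q hw))

/-- **`K·Aᵖ(X) × H^{2q}(Z) ⊆ K·Aᶜ(X × Z)`** when `K·A^q(Z) = H^{2q}(Z)` (`p + q = c`).
[cite: Kleiman1968AlgebraicCycles, §1.3] -/
theorem map₂_externalCup_algebraicClasses_top_le (hX : IsSmoothProjective n X)
    (hZ : IsSmoothProjective m Z) {p q c : ℕ} (hpq : p + q = c) (hZq : W.algebraicClasses Z q = ⊤)
    (h : 2 * p + 2 * q = 2 * c) :
    Submodule.map₂ (W.externalCup X Z h) (W.algebraicClasses X p) ⊤ ≤ W.algebraicClasses (X ⊗ Z) c := by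
  rw [← hZq]
  exact W.map₂_externalCup_algebraicClasses_le hX hZ hpq h

/-- `extTensor` maps `U ⊗ S ⊆ Hⁱ(X) ⊗ Hʲ(Z)` onto the span of the external products `x × w`, `x ∈ U`,
`w ∈ S`. [cite: Kleiman1968AlgebraicCycles, §1.2 (B)] -/
theorem extTensor_mem_map₂_externalCup {i j e : ℕ} (h : i + j = e) (U : Submodule K (W.obj X i))
    (S : Submodule K (W.obj Z j)) {t : W.obj X i ⊗[K] W.obj Z j}
    (ht : t ∈ Submodule.map₂ (TensorProduct.mk K (W.obj X i) (W.obj Z j)) U S) :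
    W.extTensor h t ∈ Submodule.map₂ (W.externalCup X Z h) U S := by
  rw [Submodule.map₂_eq_span_image2] at ht
  induction ht using Submodule.span_induction with
  | mem x hx =>
    obtain ⟨v, hv, w, hw, rfl⟩ := hx
    dsimp only
    rw [TensorProduct.mk_apply, W.extTensor_tmul]
    exact Submodule.apply_mem_map₂ _ hv hw
  | zero => rw [map_zero]; exact Submodule.zero_mem _
  | add x y _ _ hx hy => rw [map_add]; exact Submodule.add_mem _ hx hy
  | smul a x _ hx => rw [map_smul]; exact Submodule.smul_mem _ a hx

/-- The span of the external products `x × w`, `x ∈ U`, `w ∈ S`, is the image under `extTensor` of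
`U ⊗ S`. [cite: Kleiman1968AlgebraicCycles, §1.2 (B)] -/
theorem map₂_externalCup_eq_map_extTensor {i j e : ℕ} (h : i + j = e) (U : Submodule K (W.obj X i))
    (S : Submodule K (W.obj Z j)) :
    Submodule.map₂ (W.externalCup X Z h) U S =
      (Submodule.map₂ (TensorProduct.mk K (W.obj X i) (W.obj Z j)) U S).map (W.extTensor h) := by
  refine le_antisymm (Submodule.map₂_le.mpr fun x hx w hw ↦ ?_) ?_
  · exact ⟨x ⊗ₜ w, Submodule.apply_mem_map₂ _ hx hw, W.extTensor_tmul h x w⟩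
  · rintro _ ⟨t, ht, rfl⟩
    exact W.extTensor_mem_map₂_externalCup h U S ht

/-- **The Künneth component `z_{2p,2q}` of a `K`-algebraic class `z ∈ K·Aᶜ(X × Z)` lies in
`K·Aᵖ(X) ⊗ H^{2q}(Z)` whenever `K·A^{q′}(Z) = H^{2q′}(Z)`, `q + q′ = m`**: every contraction of `z_{2p,2q}`
against a functional of `H^{2q}(Z)` is a transfer `pr_{X*}(z ∪ pr_Z^* b′)` with `b′ ∈ H^{2q′}(Z) = K·A^{q′}(Z)`
(Poincaré duality), hence `K`-algebraic; no hypothesis on the rest of the cohomology of `Z`.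
[cite: Kahn2020, §3.5.1 and §6.4 Prop. 6.11 (6.4.1)] [cite: Kleiman1968AlgebraicCycles, §1.2 (A), §1.3]
[cite: Roman2008, Ch. 14 Th. 14.6 (3)] -/
theorem kunnethComponent_mem_map₂_of_mem_algebraicClasses (hX : IsSmoothProjective n X)
    (hZ : IsSmoothProjective m Z) {p q c q' : ℕ} (hpq : p + q = c) (hqq' : q + q' = m)
    (hZq' : W.algebraicClasses Z q' = ⊤) (h : 2 * p + 2 * q = 2 * c) {z : W.obj (X ⊗ Z) (2 * c)}
    (hz : z ∈ W.algebraicClasses (X ⊗ Z) c) :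
    W.kunnethComponent hX hZ (2 * p) (2 * q) h z ∈
      Submodule.map₂ (TensorProduct.mk K (W.obj X (2 * p)) (W.obj Z (2 * q))) (W.algebraicClasses X p) ⊤ := by
  haveI := W.finite_obj hZ (2 * q)
  haveI := W.finite_obj hX (2 * p)
  refine mem_map₂_top_of_forall_rid_lTensor_mem _ fun φ ↦ ?_
  by_cases hp : p ≤ n
  · have hh : 2 * q + 2 * q' = 2 * m := by omega
    haveI := W.isPerfPair_cupPairing hZ (2 * q) (2 * q') hh
    obtain ⟨b', rfl⟩ := (LinearMap.IsPerfPair.bijective_right (W.cupPairing Z m (2 * q) (2 * q') hh)).2 φ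
    rw [← W.pushforward_fst_cup_snd_eq_rid_lTensor_kunnethComponent hX hZ h hh
      (s := 2 * (c + q')) (by omega) (d' := 2 * n - 2 * p) (by omega) (by omega) z b']
    exact W.pushforward_fst_cup_snd_mem_algebraicClasses hX hZ (r := c + q') rfl (by omega) (by omega)
      (by omega) hz (by rw [hZq']; exact Submodule.mem_top)
  · haveI := W.subsingleton_obj hX (i := 2 * p) (by omega)
    rw [Subsingleton.elim (TensorProduct.rid K (W.obj X (2 * p)) _) 0]
    exact Submodule.zero_mem _

/-- The Künneth component `z_{2p,2q}` with `q > m` vanishes trivially (`H^{2q}(Z) = 0`), so lies in any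
`U ⊗ H^{2q}(Z)`. [cite: Kleiman1968AlgebraicCycles, §1.2 (A)] -/
theorem kunnethComponent_mem_map₂_of_lt (hX : IsSmoothProjective n X) (hZ : IsSmoothProjective m Z)
    {a b d : ℕ} (hb : 2 * m < b) (h : a + b = d) (U : Submodule K (W.obj X a)) (z : W.obj (X ⊗ Z) d) :
    W.kunnethComponent hX hZ a b h z ∈ Submodule.map₂ (TensorProduct.mk K (W.obj X a) (W.obj Z b)) U ⊤ := by
  haveI := W.subsingleton_obj hZ (i := b) hb
  rw [eq_zero_of_subsingleton_right (W.kunnethComponent hX hZ a b h z)]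
  exact Submodule.zero_mem _

/-! ### §3 The factor `Z` has fully algebraic cohomology -/

/-- **The Künneth components of odd bidegree vanish when `b_{odd}(Z) = 0`.**
[cite: Kleiman1968AlgebraicCycles, §1.2 (A)–(B)] -/
theorem kunnethComponent_eq_zero_of_odd_right (hX : IsSmoothProjective n X) (hZ : IsSmoothProjective m Z)
    (hZodd : ∀ j, Odd j → Module.finrank K (W.obj Z j) = 0) {a b d : ℕ} (hb : Odd b) (h : a + b = d)
    (z : W.obj (X ⊗ Z) d) : W.kunnethComponent hX hZ a b h z = 0 := by
  haveI := W.finite_obj hZ b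
  haveI : Subsingleton (W.obj Z b) := Module.finrank_zero_iff.mp (hZodd b hb)
  exact eq_zero_of_subsingleton_right _

/-- **`z ∈ K·Aᶜ(X × Z)` iff every Künneth component `z_{2p,2q}` lies in `K·Aᵖ(X) ⊗ H^{2q}(Z)`**, for `Z`
with `K·A^q(Z) = H^{2q}(Z)` for all `q` and `b_{odd}(Z) = 0` (the projective bundle ∕ cellular formula for
classes modulo homological equivalence: Kahn Prop. 6.11 (6.4.1) for `Z = 𝐏¹`, Fulton Th. 3.3 (b) for the
Chow groups of `X × 𝐏ʳ`). [cite: Kahn2020, §6.4 Prop. 6.11 (6.4.1) and Prop. 6.12]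
[cite: Fulton1998, Th. 3.3 (b)] [cite: Kleiman1968AlgebraicCycles, §1.2 (B), §1.3] -/
theorem mem_algebraicClasses_tensor_iff (hX : IsSmoothProjective n X) (hZ : IsSmoothProjective m Z)
    (hZalg : ∀ q, W.algebraicClasses Z q = ⊤) (hZodd : ∀ j, Odd j → Module.finrank K (W.obj Z j) = 0)
    {c : ℕ} (z : W.obj (X ⊗ Z) (2 * c)) :
    z ∈ W.algebraicClasses (X ⊗ Z) c ↔
      ∀ (p q : ℕ) (h : 2 * p + 2 * q = 2 * c), W.kunnethComponent hX hZ (2 * p) (2 * q) h z ∈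
        Submodule.map₂ (TensorProduct.mk K (W.obj X (2 * p)) (W.obj Z (2 * q))) (W.algebraicClasses X p) ⊤ := by
  constructor
  · intro hz p q h
    by_cases hq : q ≤ m
    · exact W.kunnethComponent_mem_map₂_of_mem_algebraicClasses hX hZ (q' := m - q) (by omega) (by omega)
        (hZalg _) h hz
    · exact W.kunnethComponent_mem_map₂_of_lt hX hZ (by omega) h _ z
  · intro hz
    rw [← W.sum_extTensor_kunnethComponent hX hZ z]
    refine Submodule.sum_mem _ fun ij _ ↦ ?_
    obtain ⟨⟨a, b⟩, hab⟩ := ij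
    have hab' : a + b = 2 * c := Finset.mem_antidiagonal.mp hab
    rcases Nat.even_or_odd b with hb | hb
    · obtain ⟨q, rfl⟩ : ∃ q, b = 2 * q := ⟨b / 2, by have := Nat.even_iff.mp hb; omega⟩
      obtain ⟨p, rfl⟩ : ∃ p, a = 2 * p := ⟨c - q, by omega⟩
      exact W.map₂_externalCup_algebraicClasses_top_le hX hZ (by omega) (hZalg q) _
        (W.extTensor_mem_map₂_externalCup _ _ _ (hz p q _))
    · rw [W.kunnethComponent_eq_zero_of_odd_right hX hZ hZodd hb, map_zero]
      exact Submodule.zero_mem _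

/-- **`K·Aᶜ(X × Z) = Σ_{p+q=c} K·Aᵖ(X) × H^{2q}(Z)`** — the `K`-span of the algebraic classes of `X × Z` is
the sum over `p + q = c` of the spans of the external products `x × w`, `x ∈ K·Aᵖ(X)`, `w ∈ H^{2q}(Z)` — for
`Z` with `K·A^q(Z) = H^{2q}(Z)` for all `q` and `b_{odd}(Z) = 0` (Kahn Prop. 6.11–6.12 for `Z = 𝐏¹` and its
powers; Fulton Th. 3.3 (b)). [cite: Kahn2020, §6.4 Prop. 6.11 (6.4.1) and Prop. 6.12]
[cite: Fulton1998, Th. 3.3 (b)] [cite: Kleiman1968AlgebraicCycles, §1.2 (B), §1.3] -/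
theorem algebraicClasses_tensor_eq_iSup (hX : IsSmoothProjective n X) (hZ : IsSmoothProjective m Z)
    (hZalg : ∀ q, W.algebraicClasses Z q = ⊤) (hZodd : ∀ j, Odd j → Module.finrank K (W.obj Z j) = 0)
    (c : ℕ) :
    W.algebraicClasses (X ⊗ Z) c =
      ⨆ (p : ℕ) (q : ℕ) (h : 2 * p + 2 * q = 2 * c),
        Submodule.map₂ (W.externalCup X Z h) (W.algebraicClasses X p) ⊤ := by
  refine le_antisymm (fun z hz ↦ ?_) ?_
  · rw [← W.sum_extTensor_kunnethComponent hX hZ z]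
    refine Submodule.sum_mem _ fun ij _ ↦ ?_
    obtain ⟨⟨a, b⟩, hab⟩ := ij
    have hab' : a + b = 2 * c := Finset.mem_antidiagonal.mp hab
    rcases Nat.even_or_odd b with hb | hb
    · obtain ⟨q, rfl⟩ : ∃ q, b = 2 * q := ⟨b / 2, by have := Nat.even_iff.mp hb; omega⟩
      obtain ⟨p, rfl⟩ : ∃ p, a = 2 * p := ⟨c - q, by omega⟩
      have key := W.extTensor_mem_map₂_externalCup (Finset.mem_antidiagonal.mp hab) _ _
        ((W.mem_algebraicClasses_tensor_iff hX hZ hZalg hZodd z).mp hz p q (Finset.mem_antidiagonal.mp hab))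
      exact Submodule.mem_iSup_of_mem p (Submodule.mem_iSup_of_mem q
        (Submodule.mem_iSup_of_mem (Finset.mem_antidiagonal.mp hab) key))
    · rw [W.kunnethComponent_eq_zero_of_odd_right hX hZ hZodd hb, map_zero]
      exact Submodule.zero_mem _
  · exact iSup_le fun p ↦ iSup_le fun q ↦ iSup_le fun h ↦
      W.map₂_externalCup_algebraicClasses_top_le hX hZ (by omega) (hZalg q) h

/-- **Products of varieties with fully algebraic cohomology have fully algebraic even cohomology**: if
`K·Aᵖ(X) = H^{2p}(X)` for all `p`, and `K·A^q(Z) = H^{2q}(Z)` for all `q` with `b_{odd}(Z) = 0`, then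
`K·Aᶜ(X × Z) = H^{2c}(X × Z)` for all `c` (e.g. `𝐏ᵃ × 𝐏ᵇ`, products of Grassmannians).
[cite: Kahn2020, §6.4 Prop. 6.11–6.12] [cite: Fulton1998, Th. 3.3 (b), Ex. 1.10.2] -/
theorem algebraicClasses_tensor_eq_top (hX : IsSmoothProjective n X) (hZ : IsSmoothProjective m Z)
    (hXalg : ∀ p, W.algebraicClasses X p = ⊤) (hZalg : ∀ q, W.algebraicClasses Z q = ⊤)
    (hZodd : ∀ j, Odd j → Module.finrank K (W.obj Z j) = 0) (c : ℕ) :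
    W.algebraicClasses (X ⊗ Z) c = ⊤ := by
  refine eq_top_iff.mpr fun z _ ↦ (W.mem_algebraicClasses_tensor_iff hX hZ hZalg hZodd z).mpr fun p q h ↦ ?_
  haveI := W.finite_obj hZ (2 * q)
  refine mem_map₂_top_of_forall_rid_lTensor_mem _ fun φ ↦ ?_
  rw [hXalg p]
  exact Submodule.mem_top

end WeilCohomology

end Literature.AlgebraicGeometry.Motives

end
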